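import Mathlib
import Summits.MatrixMultiplication.Statement
import Summits.MatrixMultiplication.MatrixMultiplication.Theorems.GraphEquationsInitialForms
import Summits.MatrixMultiplication.MatrixMultiplication.Theorems.GraphEquationsPureForms
import Summits.MatrixMultiplication.MatrixMultiplication.Theorems.GraphEquationsPureFormsNec
import Summits.MatrixMultiplication.MatrixMultiplication.Theorems.GraphEquationsPurification

/-!
# The ORDER OBSTRUCTION I: `I^e` has no isolated initial forms of order `< 2e` (`GraphEquations`, kernel M14a)

Decomp-mm node «GraphEquations» (lens 5); attacked leaf `MultiplicityReduction` (`H_mult`), open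
core `Purification` (M12: `H_mult ↔ Purification`, `S ↔ V ∧ Purification`).  Target of the node,
VERBATIM: `_root_.MatrixMultiplication`.

WITNESS OF WEAKNESS for the proposed split of `Purification` (NODE-g26 §3c «P_alg ∧ P_cost»).
`P_cost` as worded there — «along a GIVEN cost-`O(n^β)` correct family, ideal elements realising
isolated initial forms can be chosen with orders `K` bounded UNIFORMLY in `n`» — is FALSE: the
isolating elements must LEAVE the test ideal (radical-ward: root extraction / saturation), and this
module proves the obstruction.

* `vanishingOrderIdeal x a` — the ideal of polynomials whose `θ_x`-shifted weighted components of
  orders `< a` vanish; `generator_mem_vanishingOrderIdeal_two`, `graphIdeal_pow_le_vanishingOrderIdeal`: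
  `I^e ≤ vanishingOrderIdeal x (2e)` for `I = (f_q)_q` and every `x ∈ W_n`
  (`bind₁_shift_generator`: `θ_x` FIXES every generator when `x ∈ W_n`);
* `EqSystem.not_pureIsolatedAt_of_tests_mem_pow`, `EqSystem.not_initNondegAt_of_tests_mem_pow`:
  a system (`n ≥ 1`) whose tests lie in `I^e` is NOT pure-isolated and NOT initial-form
  nondegenerate to any order `K < 2e`, at ANY point of the graph — and the same holds for every
  system whose tests lie in the IDEAL of such tests (`…_of_tests_mem_ideal`);
* the companion module `GraphEquationsSquaredSystems` (kernel M14b) squares the tests of an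
  arbitrary correct system `k` times at linear cost and derives the family-level obstruction
  `exists_family_without_inIdeal_purification` for EVERY admissible exponent.

Reading for the line: any purification procedure must be insensitive to `e` in `t = f^e`-type
degeneracies (root extraction costs `O(size)` independently of `e`; Kaltofen 1987 for factors of
small degree), i.e. it is a statement about the RADICAL / saturation of cheap ideals, not about
standard bases of the ideals themselves.

No `sorry`.  Sources: [BurgisserClausenShokrollahi1997, Problem 16.3, Thm. (2.21) Kaltofen];
[Strassen1973]; T. Mora, *An algorithm to compute the equations of tangent cones* (EUROCAM 1982).
-/

set_option linter.dupNamespace false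

noncomputable section

open scoped BigOperators

namespace Summit.MatrixMultiplication.MatrixMultiplication.Theorems.GraphEquations

open MvPolynomial
open Literature.Computability.AlgebraicComplexity
open Literature.Computability.AlgebraicComplexity.ArithCircuit

variable {n : ℕ}

/-! ## `θ_x` fixes the generators (`x ∈ W_n`) -/

/-- `θ_x(f_q) = f_q + (x_{c,q} − Σ_k x_{a,q₁k} x_{b,kq₂})` for every `x`. -/
theorem bind₁_shift_generator_eq (x : GraphVars n → ℂ) (q : Fin n × Fin n) :
    bind₁ (shift x) (generator n q) = generator n q +
      C (x (Sum.inr q) - ∑ k : Fin n, x (Sum.inl (Sum.inl (q.1, k))) * x (Sum.inl (Sum.inr (k, q.2)))) := by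
  obtain ⟨i, l⟩ := q
  simp only [generator, map_sub, map_sum, map_mul, bind₁_X_right, shift]
  have key : ∀ k : Fin n,
      ((X (Sum.inl (Sum.inl (i, k))) + C (x (Sum.inl (Sum.inl (i, k))))) *
          (X (Sum.inl (Sum.inr (k, l))) + C (x (Sum.inl (Sum.inr (k, l))))) :
          MvPolynomial (GraphVars n) ℂ) =
        X (Sum.inl (Sum.inl (i, k))) * X (Sum.inl (Sum.inr (k, l))) +
          (x (Sum.inl (Sum.inl (i, k))) • X (Sum.inl (Sum.inr (k, l))) +
            x (Sum.inl (Sum.inr (k, l))) • X (Sum.inl (Sum.inl (i, k)))) +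
          C (x (Sum.inl (Sum.inl (i, k)))) * C (x (Sum.inl (Sum.inr (k, l)))) := by
    intro k
    simp only [smul_eq_C_mul]
    ring
  rw [Finset.sum_congr rfl fun k _ => key k]
  simp only [Finset.sum_add_distrib]
  ring

/-- **`θ_x` fixes `f_q` when `x ∈ W_n`.** -/
theorem bind₁_shift_generator {x : GraphVars n → ℂ} (hx : x ∈ mmGraph n) (q : Fin n × Fin n) :
    bind₁ (shift x) (generator n q) = generator n q := by
  rw [bind₁_shift_generator_eq, hx q.1 q.2, sub_self, C_0, add_zero]

/-! ## The vanishing-order ideals and `I^e` -/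

/-- Polynomials whose `θ_x`-shifted weighted components of all orders `< a` vanish
(«vanishing to weighted order `≥ a` at `x`»).  An ideal. -/
def vanishingOrderIdeal (x : GraphVars n → ℂ) (a : ℕ) : Ideal (MvPolynomial (GraphVars n) ℂ) where
  carrier := {u | ∀ m < a, weightedHomogeneousComponent (gw n) m (bind₁ (shift x) u) = 0}
  zero_mem' := by
    intro m _
    simp
  add_mem' := by
    intro u v hu hv m hm
    simp only [Set.mem_setOf_eq] at hu hv
    simp [map_add, hu m hm, hv m hm]
  smul_mem' := by
    intro r u hu m hm
    simp only [Set.mem_setOf_eq] at hu ⊢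
    rw [smul_eq_mul, map_mul, weightedHomogeneousComponent_mul]
    refine Finset.sum_eq_zero fun ij hij => ?_
    rw [Finset.HasAntidiagonal.mem_antidiagonal] at hij
    rw [hu ij.2 (by omega), mul_zero]

/-- Membership in `vanishingOrderIdeal x a`, unfolded. -/
theorem mem_vanishingOrderIdeal_iff {x : GraphVars n → ℂ} {a : ℕ} {u : MvPolynomial (GraphVars n) ℂ} :
    u ∈ vanishingOrderIdeal x a ↔
      ∀ m < a, weightedHomogeneousComponent (gw n) m (bind₁ (shift x) u) = 0 :=
  Iff.rfl

/-- Orders add under products: `(u v)_m = Σ_{i+j=m} u_i v_j`. -/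
theorem mul_mem_vanishingOrderIdeal {x : GraphVars n → ℂ} {a b : ℕ}
    {u v : MvPolynomial (GraphVars n) ℂ} (hu : u ∈ vanishingOrderIdeal x a)
    (hv : v ∈ vanishingOrderIdeal x b) : u * v ∈ vanishingOrderIdeal x (a + b) := by
  rw [mem_vanishingOrderIdeal_iff] at hu hv ⊢
  intro m hm
  rw [map_mul, weightedHomogeneousComponent_mul]
  refine Finset.sum_eq_zero fun ij hij => ?_
  rw [Finset.HasAntidiagonal.mem_antidiagonal] at hij
  by_cases h : ij.1 < a
  · rw [hu ij.1 h, zero_mul]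
  · rw [hv ij.2 (by omega), mul_zero]

/-- `V_a · V_b ≤ V_{a+b}` for the vanishing-order ideals `V_a = vanishingOrderIdeal x a`. -/
theorem vanishingOrderIdeal_mul_le (x : GraphVars n → ℂ) (a b : ℕ) :
    vanishingOrderIdeal x a * vanishingOrderIdeal x b ≤ vanishingOrderIdeal x (a + b) :=
  Ideal.mul_le.mpr fun _ hu _ hv => mul_mem_vanishingOrderIdeal hu hv

/-- The vanishing-order ideals decrease in the order. -/
theorem vanishingOrderIdeal_anti (x : GraphVars n → ℂ) {a b : ℕ} (hab : a ≤ b) :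
    vanishingOrderIdeal x b ≤ vanishingOrderIdeal x a :=
  fun _ hu m hm => hu m (lt_of_lt_of_le hm hab)

/-- `f_q` vanishes to weighted order `2` at every point of the graph. -/
theorem generator_mem_vanishingOrderIdeal_two {x : GraphVars n → ℂ} (hx : x ∈ mmGraph n)
    (q : Fin n × Fin n) : generator n q ∈ vanishingOrderIdeal x 2 := by
  intro m hm
  rw [bind₁_shift_generator hx, weightedHomogeneousComponent_generator, if_neg (by omega)]

/-- The ideal `I = (f_q)_q` of the graph. -/
def graphIdeal (n : ℕ) : Ideal (MvPolynomial (GraphVars n) ℂ) :=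
  Ideal.span (Set.range (generator n))

/-- `f_q ∈ I`. -/
theorem generator_mem_graphIdeal (q : Fin n × Fin n) : generator n q ∈ graphIdeal n :=
  Ideal.subset_span ⟨q, rfl⟩

/-- Graph Nullstellensatz (M9b), restated: vanishing on `W_n` ⇒ in `I`. -/
theorem mem_graphIdeal_of_vanishing {t : MvPolynomial (GraphVars n) ℂ}
    (ht : ∀ y ∈ mmGraph n, eval y t = 0) : t ∈ graphIdeal n :=
  mem_span_generator_of_vanishing ht

/-- `I` vanishes to weighted order `2` at every point of the graph. -/
theorem graphIdeal_le_vanishingOrderIdeal {x : GraphVars n → ℂ} (hx : x ∈ mmGraph n) :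
    graphIdeal n ≤ vanishingOrderIdeal x 2 :=
  Ideal.span_le.mpr (by rintro _ ⟨q, rfl⟩; exact generator_mem_vanishingOrderIdeal_two hx q)

/-- **`I^e` vanishes to weighted order `2e` at every point of the graph.** -/
theorem graphIdeal_pow_le_vanishingOrderIdeal {x : GraphVars n → ℂ} (hx : x ∈ mmGraph n) (e : ℕ) :
    graphIdeal n ^ e ≤ vanishingOrderIdeal x (2 * e) := by
  induction e with
  | zero =>
    intro u _ m hm
    omega
  | succ e ih =>
    rw [pow_succ]
    calc graphIdeal n ^ e * graphIdeal n
        ≤ vanishingOrderIdeal x (2 * e) * vanishingOrderIdeal x 2 :=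
          Ideal.mul_mono ih (graphIdeal_le_vanishingOrderIdeal hx)
      _ ≤ vanishingOrderIdeal x (2 * e + 2) := vanishingOrderIdeal_mul_le x _ _
      _ = vanishingOrderIdeal x (2 * (e + 1)) := by ring_nf

/-- Element form. -/
theorem weightedHomogeneousComponent_shift_eq_zero_of_mem_pow {x : GraphVars n → ℂ}
    (hx : x ∈ mmGraph n) {e : ℕ} {u : MvPolynomial (GraphVars n) ℂ} (hu : u ∈ graphIdeal n ^ e)
    {m : ℕ} (hm : m < 2 * e) :
    weightedHomogeneousComponent (gw n) m (bind₁ (shift x) u) = 0 :=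
  graphIdeal_pow_le_vanishingOrderIdeal hx e hu m hm

/-! ## Systems with tests in `I^e` have no bounded-order isolated initial forms -/

namespace EqSystem

/-- **No pure isolated initial forms of order `< 2e` when the tests lie in `I^e`** (`n ≥ 1`, any
point of the graph): every candidate pure form `P_o` of order `≤ K < 2e` is `0`, and the fibre of
`P = 0` through `0` is everything. -/
theorem not_pureIsolatedAt_of_tests_mem_pow (hn : 1 ≤ n) {E : EqSystem n} {e K : ℕ}
    (hK : K < 2 * e) (hE : ∀ o : Fin E.tests.length, E.testPoly (E.tests.get o) ∈ graphIdeal n ^ e)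
    {x : GraphVars n → ℂ} (hx : x ∈ mmGraph n) : ¬ E.PureIsolatedAt K x := by
  rintro ⟨m, P, hm, hinit, hiso⟩
  have hP : ∀ o, P o = 0 := fun o => by
    apply aeval_generator_injective
    rw [← hinit o, map_zero]
    exact weightedHomogeneousComponent_shift_eq_zero_of_mem_pow hx (hE o)
      (lt_of_le_of_lt (hm o) hK)
  have h1 := hiso (fun _ => 1) (fun o => by simp [hP o])
  have h2 := congr_fun h1 (⟨0, hn⟩, ⟨0, hn⟩)
  simp at h2

/-- **No initial-form nondegeneracy of order `< 2e` when the tests lie in `I^e`**: the gradient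
matrix of `P = 0` is `0`, of rank `0 < n²`. -/
theorem not_initNondegAt_of_tests_mem_pow (hn : 1 ≤ n) {E : EqSystem n} {e K : ℕ}
    (hK : K < 2 * e) (hE : ∀ o : Fin E.tests.length, E.testPoly (E.tests.get o) ∈ graphIdeal n ^ e)
    {x : GraphVars n → ℂ} (hx : x ∈ mmGraph n) : ¬ E.InitNondegAt K x := by
  rintro ⟨m, P, γ, hm, hinit, hrank⟩
  have hP : ∀ o, P o = 0 := fun o => by
    apply aeval_generator_injective
    rw [← hinit o, map_zero]
    exact weightedHomogeneousComponent_shift_eq_zero_of_mem_pow hx (hE o)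
      (lt_of_le_of_lt (hm o) hK)
  have hG : gradMatrix γ P = 0 := by
    ext o q
    simp [gradMatrix, hP o]
  rw [hG, Matrix.rank_zero] at hrank
  have : 1 ≤ n * n := Nat.one_le_iff_ne_zero.mpr (Nat.mul_ne_zero (by omega) (by omega))
  omega

/-- The same for every system whose tests lie in the IDEAL generated by tests in `I^e`
(in-ideal recombination cannot lower the order). -/
theorem not_pureIsolatedAt_of_tests_mem_ideal (hn : 1 ≤ n) {E E' : EqSystem n} {e K : ℕ}
    (hK : K < 2 * e) (hE : ∀ o : Fin E.tests.length, E.testPoly (E.tests.get o) ∈ graphIdeal n ^ e)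
    (hE' : ∀ o : Fin E'.tests.length, E'.testPoly (E'.tests.get o) ∈
      Ideal.span (Set.range fun o : Fin E.tests.length => E.testPoly (E.tests.get o)))
    {x : GraphVars n → ℂ} (hx : x ∈ mmGraph n) : ¬ E'.PureIsolatedAt K x := by
  refine not_pureIsolatedAt_of_tests_mem_pow hn hK (fun o => ?_) hx
  have hle : Ideal.span (Set.range fun o : Fin E.tests.length => E.testPoly (E.tests.get o)) ≤
      graphIdeal n ^ e :=
    Ideal.span_le.mpr (by rintro _ ⟨o, rfl⟩; exact hE o)
  exact hle (hE' o)

/-- In-ideal recombination cannot lower the order (initial-form nondegenerate version). -/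
theorem not_initNondegAt_of_tests_mem_ideal (hn : 1 ≤ n) {E E' : EqSystem n} {e K : ℕ}
    (hK : K < 2 * e) (hE : ∀ o : Fin E.tests.length, E.testPoly (E.tests.get o) ∈ graphIdeal n ^ e)
    (hE' : ∀ o : Fin E'.tests.length, E'.testPoly (E'.tests.get o) ∈
      Ideal.span (Set.range fun o : Fin E.tests.length => E.testPoly (E.tests.get o)))
    {x : GraphVars n → ℂ} (hx : x ∈ mmGraph n) : ¬ E'.InitNondegAt K x := by
  refine not_initNondegAt_of_tests_mem_pow hn hK (fun o => ?_) hx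
  have hle : Ideal.span (Set.range fun o : Fin E.tests.length => E.testPoly (E.tests.get o)) ≤
      graphIdeal n ^ e :=
    Ideal.span_le.mpr (by rintro _ ⟨o, rfl⟩; exact hE o)
  exact hle (hE' o)

end EqSystem

end Summit.MatrixMultiplication.MatrixMultiplication.Theorems.GraphEquations
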